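import Summits.FinalStateConjecture.FinalStateConjecture.Theorems.EIHFluxBalanceInertialRecessionChargeKinematicsTightPair

/-!
# Route EIHFluxBalance — `InertialRecession`, line `old-light-leaves-the-cone`: charge kinematics,
# XV (velocity increment of a member of the tight pair)

Helper file for the crux `stmt-FinalStateConjecture-10166`
(`Summit.FinalStateConjecture.FinalStateConjecture.Theses.EIHFluxBalance.InertialRecession`), second line
lead, endgame stub `stub_expandingChargeKinematics` (S4: abstract quasi-conserved window charges with the
slack-form window law and the single-hole identification ⇒ Cesàro velocities of the painted centres).
THE ESCAPE SERIES: the endgame for `N = 3` (Case A all-pairs freezing is `ChargeKinematicsAllPairs*`;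
Case B, the escape of a fast hole from a velocity-tight pair, is this series; the assembly is
`ChargeKinematicsThree`).

XV — THE VELOCITY INCREMENT OF A MEMBER OF THE TIGHT PAIR over the four regimes
(`tight_pair_member_increment_le`): singleton law on WIDE and PASSAGE, pair window law along
`min(|φ|/2, c₂s)` on APPROACH and RECESSION (plus `3β₀` from the internal motion each).

Every statement is Mathlib-only real analysis over the stub's verbatim hypotheses ([folklore]); the abstract
charge `P` is arbitrary (adversarial), constrained only by the window law and the identification.
-/

set_option linter.dupNamespace false

noncomputable section

open Filter Set Metric Real
open scoped Topology

namespace Summit.FinalStateConjecture.FinalStateConjecture.Theorems.ChargeKinematics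

open Literature.Geometry.Lorentzian

/-! ## The member of the tight pair -/

section TightPairMember

open MeasureTheory intervalIntegral

/-- **Velocity increment of a member of the tight pair during the escape (four regimes).** Abstract
form. Hole `x` (mass `M_x`, painted velocity `v_x`, charge `Q_x` read along its nearest-neighbour radius
`R_x ≥ min(min(d_{bx}, d)/3, c₂s)` with a singleton law), its slow partner `y` at distance `d`
(`|Δd| ≤ 2β₀Δs`, `d ≥ m₀`, relative velocity `≤ 3β₀/2`), the escaper `b` flying by (`d_{bx} ≥ max(m₀,|φ₁|)`,
`φ₁' ≥ g`) and the regime coordinate `φ` (`φ' ≥ g`) with the PAIR WINDOW LAW along `min(|φ|/2, c₂s)`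
available on every sub-interval where `4d ≤ |φ|` and `2d ≤ c₂s`. Then over `[t₀, τ]` the velocity of `x`
moves by at most the sum of the four regime bounds (WIDE and PASSAGE: singleton law; APPROACH and
RECESSION: pair law + `3β₀` from the internal motion), given by `regime_split` for
`k = c₂s/2 − d`, `g⁻ = −φ − 4d`, `g⁺ = φ − 4d`. [folklore] -/
theorem tight_pair_member_increment_le {ξx ξb vx vy : ℝ → E3} {Qx Qw : ℝ → Fin 4 → ℝ}
    {Rx ex ew d φ φ' φ₁ φ₁' : ℝ → ℝ} {Mx My Cx Cw k t₀ τ m₀ c₂ g β₀ ε : ℝ}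
    (hMx : 0 < Mx) (hMy : 0 < My) (hk1 : k < 1) (ht₀ : 1 ≤ t₀) (hτ : t₀ ≤ τ) (hm₀ : 1 ≤ m₀)
    (hc₂ : 0 < c₂) (hct : 1 ≤ c₂ * t₀) (hg : 0 < g) (hβ₀ : 0 < β₀) (hβg : 64 * β₀ ≤ g)
    (hβc : 4 * β₀ ≤ c₂) (hCx : 0 ≤ Cx) (hCw : 0 ≤ Cw) (hε : 0 ≤ ε)
    (hdx : Differentiable ℝ ξx) (hξb : Continuous ξb)
    (hvxk : ∀ s ∈ Set.Icc t₀ τ, ‖vx s‖ ≤ k) (hvyk : ∀ s ∈ Set.Icc t₀ τ, ‖vy s‖ ≤ k)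
    (hdcont : Continuous d) (hdfloor : ∀ s ∈ Set.Icc t₀ τ, m₀ ≤ d s)
    (hdslow : ∀ s ∈ Set.Icc t₀ τ, ∀ s' ∈ Set.Icc t₀ τ, s ≤ s' → |d s' - d s| ≤ 2 * β₀ * (s' - s))
    (hrxy : ∀ s ∈ Set.Icc t₀ τ, ‖vy s - vx s‖ ≤ 3 * β₀ / 2)
    (hlawx : ∀ t₁ t₂, t₀ ≤ t₁ → t₁ ≤ t₂ → t₂ ≤ τ → ∀ μ : Fin 4, |Qx t₂ μ - Qx t₁ μ| ≤
      Cx * (∫ s in t₁..t₂, ((Rx s) ^ 2)⁻¹ + ((Rx s) ^ (7 / 4 : ℝ))⁻¹) + ex t₁)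
    (hidx : ∀ t ∈ Set.Icc t₀ τ, |Qx t 0 - Mx * (√(1 - ‖vx t‖ ^ 2))⁻¹| ≤ ex t ∧
      ∀ k' : Fin 3, |Qx t k'.succ - Mx * (√(1 - ‖vx t‖ ^ 2))⁻¹ * vx t k'| ≤ ex t)
    (hex : ∀ t ∈ Set.Icc t₀ τ, ex t ≤ ε)
    (hRxc : ContinuousOn Rx (Set.Icc t₀ τ)) (hRx1 : ∀ s ∈ Set.Icc t₀ τ, 1 ≤ Rx s)
    (hRxge : ∀ s ∈ Set.Icc t₀ τ, min (min ‖ξb s - ξx s‖ (d s) / 3) (c₂ * s) ≤ Rx s)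
    (hφ₁ : ∀ s, HasDerivAt φ₁ (φ₁' s) s) (hφ₁' : Continuous φ₁')
    (hmono₁ : ∀ s ∈ Set.Icc t₀ τ, g ≤ φ₁' s)
    (hfl₁ : ∀ s ∈ Set.Icc t₀ τ, max m₀ |φ₁ s| ≤ ‖ξb s - ξx s‖)
    (hφ : ∀ s, HasDerivAt φ (φ' s) s) (hφ' : Continuous φ') (hmono : ∀ s ∈ Set.Icc t₀ τ, g ≤ φ' s)
    (hpair : ∀ s₁ s₂, t₀ ≤ s₁ → s₁ ≤ s₂ → s₂ ≤ τ →
      (∀ s ∈ Set.Icc s₁ s₂, 4 * d s ≤ |φ s| ∧ 2 * d s ≤ c₂ * s) →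
      (∀ μ : Fin 4, |Qw s₂ μ - Qw s₁ μ| ≤
        Cw * (∫ s in s₁..s₂, ((min (|φ s| / 2) (c₂ * s)) ^ 2)⁻¹ +
          ((min (|φ s| / 2) (c₂ * s)) ^ (7 / 4 : ℝ))⁻¹) + ew s₁) ∧
      (∀ s ∈ Set.Icc s₁ s₂, |Qw s 0 - (Mx * (√(1 - ‖vx s‖ ^ 2))⁻¹ + My * (√(1 - ‖vy s‖ ^ 2))⁻¹)| ≤ ew s ∧
        ∀ k' : Fin 3, |Qw s k'.succ - (Mx * (√(1 - ‖vx s‖ ^ 2))⁻¹ * vx s k' +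
          My * (√(1 - ‖vy s‖ ^ 2))⁻¹ * vy s k')| ≤ ew s))
    (hew : ∀ t ∈ Set.Icc t₀ τ, ew t ≤ ε) :
    ‖vx τ - vx t₀‖ ≤
      4 * (Cx * (9 * (2 * 2 * m₀ ^ (1 - 2 : ℝ) / ((2 - 1) * g)) +
        (3 : ℝ) ^ (7 / 4 : ℝ) * (2 * (7 / 4) * m₀ ^ (1 - 7 / 4 : ℝ) / ((7 / 4 - 1) * g)) +
        (((c₂ / 6) ^ 2 * t₀)⁻¹ + 4 / 3 * (c₂ / 6) ^ (-(7 / 4) : ℝ) * t₀ ^ (-(3 / 4) : ℝ))) + 3 * ε) / Mx +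
      (4 * (Cx * ((9 * (2 * 2 * m₀ ^ (1 - 2 : ℝ) / ((2 - 1) * g)) +
        (3 : ℝ) ^ (7 / 4 : ℝ) * (2 * (7 / 4) * m₀ ^ (1 - 7 / 4 : ℝ) / ((7 / 4 - 1) * g)) +
        ((c₂ ^ 2 * t₀)⁻¹ + 4 / 3 * c₂ ^ (-(7 / 4) : ℝ) * t₀ ^ (-(3 / 4) : ℝ))) +
        1152 / g * m₀ ^ (-(3 / 4) : ℝ)) + 3 * ε) / Mx) +
      2 * (4 * (Cw * (9 * (2 * 2 * m₀ ^ (1 - 2 : ℝ) / ((2 - 1) * g)) +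
        (3 : ℝ) ^ (7 / 4 : ℝ) * (2 * (7 / 4) * m₀ ^ (1 - 7 / 4 : ℝ) / ((7 / 4 - 1) * g)) +
        ((c₂ ^ 2 * t₀)⁻¹ + 4 / 3 * c₂ ^ (-(7 / 4) : ℝ) * t₀ ^ (-(3 / 4) : ℝ))) + 3 * ε) / (Mx + My) +
        3 * β₀) := by
  -- opaque abbreviations for the four budget constants
  obtain ⟨Fg, hFg⟩ : ∃ x : ℝ, x = 9 * (2 * 2 * m₀ ^ (1 - 2 : ℝ) / ((2 - 1) * g)) +
      (3 : ℝ) ^ (7 / 4 : ℝ) * (2 * (7 / 4) * m₀ ^ (1 - 7 / 4 : ℝ) / ((7 / 4 - 1) * g)) := ⟨_, rfl⟩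
  obtain ⟨T₆, hT₆⟩ : ∃ x : ℝ, x = ((c₂ / 6) ^ 2 * t₀)⁻¹ +
      4 / 3 * (c₂ / 6) ^ (-(7 / 4) : ℝ) * t₀ ^ (-(3 / 4) : ℝ) := ⟨_, rfl⟩
  obtain ⟨T₁, hT₁⟩ : ∃ x : ℝ, x = (c₂ ^ 2 * t₀)⁻¹ + 4 / 3 * c₂ ^ (-(7 / 4) : ℝ) * t₀ ^ (-(3 / 4) : ℝ) :=
    ⟨_, rfl⟩
  obtain ⟨Λm, hΛm⟩ : ∃ x : ℝ, x = 1152 / g * m₀ ^ (-(3 / 4) : ℝ) := ⟨_, rfl⟩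
  have hadd : Fg + T₁ = 9 * (2 * 2 * m₀ ^ (1 - 2 : ℝ) / ((2 - 1) * g)) +
      (3 : ℝ) ^ (7 / 4 : ℝ) * (2 * (7 / 4) * m₀ ^ (1 - 7 / 4 : ℝ) / ((7 / 4 - 1) * g)) +
      ((c₂ ^ 2 * t₀)⁻¹ + 4 / 3 * c₂ ^ (-(7 / 4) : ℝ) * t₀ ^ (-(3 / 4) : ℝ)) := by rw [hFg, hT₁]
  have hadd6 : Fg + T₆ = 9 * (2 * 2 * m₀ ^ (1 - 2 : ℝ) / ((2 - 1) * g)) +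
      (3 : ℝ) ^ (7 / 4 : ℝ) * (2 * (7 / 4) * m₀ ^ (1 - 7 / 4 : ℝ) / ((7 / 4 - 1) * g)) +
      (((c₂ / 6) ^ 2 * t₀)⁻¹ + 4 / 3 * (c₂ / 6) ^ (-(7 / 4) : ℝ) * t₀ ^ (-(3 / 4) : ℝ)) := by rw [hFg, hT₆]
  have haddΛ : Fg + T₁ + Λm = 9 * (2 * 2 * m₀ ^ (1 - 2 : ℝ) / ((2 - 1) * g)) +
      (3 : ℝ) ^ (7 / 4 : ℝ) * (2 * (7 / 4) * m₀ ^ (1 - 7 / 4 : ℝ) / ((7 / 4 - 1) * g)) +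
      ((c₂ ^ 2 * t₀)⁻¹ + 4 / 3 * c₂ ^ (-(7 / 4) : ℝ) * t₀ ^ (-(3 / 4) : ℝ)) +
      1152 / g * m₀ ^ (-(3 / 4) : ℝ) := by rw [hFg, hT₁, hΛm]
  rw [← hadd6, ← haddΛ, ← hadd]
  have ht₀pos : 0 < t₀ := one_pos.trans_le ht₀
  have hm₀pos : 0 < m₀ := one_pos.trans_le hm₀
  have hFgnn : 0 ≤ Fg := by rw [hFg]; positivity
  have hT₁nn : 0 ≤ T₁ := by rw [hT₁]; positivity
  have hT₆nn : 0 ≤ T₆ := by rw [hT₆]; positivity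
  have hΛmnn : 0 ≤ Λm := by rw [hΛm]; positivity
  have hφc : Continuous φ := continuous_iff_continuousAt.mpr fun s ↦ (hφ s).continuousAt
  -- `φ` grows at rate `≥ g` on `[t₀, τ]`
  have hφgrow : ∀ s ∈ Set.Icc t₀ τ, ∀ s' ∈ Set.Icc t₀ τ, s ≤ s' → g * (s' - s) ≤ φ s' - φ s := by
    intro s hs s' hs' hss'
    have hconv : Convex ℝ (Set.Icc t₀ τ) := convex_Icc t₀ τ
    have hcont' : ContinuousOn φ (Set.Icc t₀ τ) := hφc.continuousOn
    have hdiff' : DifferentiableOn ℝ φ (interior (Set.Icc t₀ τ)) := fun x _ ↦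
      (hφ x).differentiableAt.differentiableWithinAt
    have hge : ∀ x ∈ interior (Set.Icc t₀ τ), g ≤ deriv φ x := by
      intro x hx
      rw [interior_Icc] at hx
      rw [(hφ x).deriv]
      exact hmono x ⟨hx.1.le, hx.2.le⟩
    exact hconv.mul_sub_le_image_sub_of_le_deriv hcont' hdiff' hge s hs s' hs' hss'
  -- the three regime functions and their monotonicity
  obtain ⟨kf, hkf⟩ : ∃ f : ℝ → ℝ, ∀ s, f s = c₂ * s / 2 - d s := ⟨_, fun s ↦ rfl⟩
  obtain ⟨gm, hgm⟩ : ∃ f : ℝ → ℝ, ∀ s, f s = -φ s - 4 * d s := ⟨_, fun s ↦ rfl⟩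
  obtain ⟨gp, hgp⟩ : ∃ f : ℝ → ℝ, ∀ s, f s = φ s - 4 * d s := ⟨_, fun s ↦ rfl⟩
  have hkc : Continuous kf := by
    have : kf = fun s ↦ c₂ * s / 2 - d s := funext hkf
    rw [this]; exact ((continuous_const.mul continuous_id).div_const 2).sub hdcont
  have hgmc : Continuous gm := by
    have : gm = fun s ↦ -φ s - 4 * d s := funext hgm
    rw [this]; exact hφc.neg.sub (continuous_const.mul hdcont)
  have hgpc : Continuous gp := by
    have : gp = fun s ↦ φ s - 4 * d s := funext hgp
    rw [this]; exact hφc.sub (continuous_const.mul hdcont)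
  have hkmono : ∀ s s', t₀ ≤ s → s ≤ s' → s' ≤ τ → 0 ≤ kf s → 0 ≤ kf s' := by
    intro s s' hs hss' hs' h
    have hd := hdslow s ⟨hs, hss'.trans hs'⟩ s' ⟨hs.trans hss', hs'⟩ hss'
    rw [abs_le] at hd
    rw [hkf] at h ⊢
    nlinarith only [hd.2, h, hβc, hss', hβ₀]
  have hgmmono : ∀ s s', t₀ ≤ s → s ≤ s' → s' ≤ τ → 0 ≤ gm s' → 0 ≤ gm s := by
    intro s s' hs hss' hs' h
    have hd := hdslow s ⟨hs, hss'.trans hs'⟩ s' ⟨hs.trans hss', hs'⟩ hss'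
    have hφg := hφgrow s ⟨hs, hss'.trans hs'⟩ s' ⟨hs.trans hss', hs'⟩ hss'
    rw [abs_le] at hd
    rw [hgm] at h ⊢
    nlinarith only [hd.1, hd.2, h, hφg, hβg, hss', hβ₀]
  have hgpmono : ∀ s s', t₀ ≤ s → s ≤ s' → s' ≤ τ → 0 ≤ gp s → 0 ≤ gp s' := by
    intro s s' hs hss' hs' h
    have hd := hdslow s ⟨hs, hss'.trans hs'⟩ s' ⟨hs.trans hss', hs'⟩ hss'
    have hφg := hφgrow s ⟨hs, hss'.trans hs'⟩ s' ⟨hs.trans hss', hs'⟩ hss'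
    rw [abs_le] at hd
    rw [hgp] at h ⊢
    nlinarith only [hd.1, hd.2, h, hφg, hβg, hss', hβ₀]
  obtain ⟨σ₁, σ₂, σ₃, h01, h12, h23, h3τ, hW, hA, hPa, hRe⟩ :=
    regime_split hτ hkc hgmc hgpc hkmono hgmmono hgpmono
  have hσ₁I : σ₁ ∈ Set.Icc t₀ τ := ⟨h01, h12.trans (h23.trans h3τ)⟩
  have hσ₂I : σ₂ ∈ Set.Icc t₀ τ := ⟨h01.trans h12, h23.trans h3τ⟩
  have hσ₃I : σ₃ ∈ Set.Icc t₀ τ := ⟨(h01.trans h12).trans h23, h3τ⟩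
  have ht₀I : t₀ ∈ Set.Icc t₀ τ := ⟨le_rfl, hτ⟩
  have hτI : τ ∈ Set.Icc t₀ τ := ⟨hτ, le_rfl⟩
  -- generic singleton increment from an integral bound
  have hsing : ∀ t₁ t₂ (B : ℝ), t₀ ≤ t₁ → t₁ ≤ t₂ → t₂ ≤ τ →
      ∫ s in t₁..t₂, (((Rx s) ^ 2)⁻¹ + ((Rx s) ^ (7 / 4 : ℝ))⁻¹) ≤ B →
      ‖vx t₂ - vx t₁‖ ≤ 4 * (Cx * B + 3 * ε) / Mx := by
    intro t₁ t₂ B h1 h12' h2 hB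
    have h1I : t₁ ∈ Set.Icc t₀ τ := ⟨h1, h12'.trans h2⟩
    have h2I : t₂ ∈ Set.Icc t₀ τ := ⟨h1.trans h12', h2⟩
    have hL : Cx * (∫ s in t₁..t₂, (((Rx s) ^ 2)⁻¹ + ((Rx s) ^ (7 / 4 : ℝ))⁻¹)) + ex t₁ ≤ Cx * B + ε := by
      have := mul_le_mul_of_nonneg_left hB hCx
      linarith only [this, hex t₁ h1I]
    have h := velocity_increment_le hMx ((hvxk t₂ h2I).trans_lt hk1) ((hvxk t₁ h1I).trans hk1.le)
      (hidx t₂ h2I) (hidx t₁ h1I) (fun μ ↦ (hlawx t₁ t₂ h1 h12' h2 μ).trans hL)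
    refine h.trans (div_le_div_of_nonneg_right ?_ hMx.le)
    linarith only [hex t₁ h1I, hex t₂ h2I]
  -- generic pair increment on an admissible sub-interval
  have hpairinc : ∀ s₁ s₂, t₀ ≤ s₁ → s₁ ≤ s₂ → s₂ ≤ τ →
      (∀ s ∈ Set.Icc s₁ s₂, 4 * d s ≤ |φ s| ∧ 2 * d s ≤ c₂ * s) →
      ‖vx s₂ - vx s₁‖ ≤ 4 * (Cw * (Fg + T₁) + 3 * ε) / (Mx + My) + 3 * β₀ := by
    intro s₁ s₂ h1 h12' h2 hgeom
    have h1I : s₁ ∈ Set.Icc t₀ τ := ⟨h1, h12'.trans h2⟩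
    have h2I : s₂ ∈ Set.Icc t₀ τ := ⟨h1.trans h12', h2⟩
    have hsub : Set.Icc s₁ s₂ ⊆ Set.Icc t₀ τ := Set.Icc_subset_Icc h1 h2
    obtain ⟨hlaw, hid⟩ := hpair s₁ s₂ h1 h12' h2 hgeom
    have hs₁pos : 0 < s₁ := ht₀pos.trans_le h1
    -- the budget of the pair window
    have hRwc : ContinuousOn (fun s ↦ min (|φ s| / 2) (c₂ * s)) (Set.Icc s₁ s₂) :=
      ((hφc.abs.div_const 2).min (continuous_const.mul continuous_id)).continuousOn
    have hRw1 : ∀ s ∈ Set.Icc s₁ s₂, 1 ≤ min (|φ s| / 2) (c₂ * s) := by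
      intro s hs
      obtain ⟨h4, -⟩ := hgeom s hs
      have hm := hdfloor s (hsub hs)
      refine le_min (by linarith only [h4, hm, hm₀]) ?_
      have : t₀ ≤ s := (hsub hs).1
      nlinarith only [hct, this, hc₂]
    have hRwge : ∀ s ∈ Set.Icc s₁ s₂, min (max m₀ |φ s| / 3) (c₂ * s) ≤ min (|φ s| / 2) (c₂ * s) := by
      intro s hs
      obtain ⟨h4, -⟩ := hgeom s hs
      have hm := hdfloor s (hsub hs)
      have hmax : max m₀ |φ s| = |φ s| := max_eq_right (by linarith only [h4, hm, hm₀])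
      rw [hmax]
      exact min_le_min (by linarith only [abs_nonneg (φ s)]) le_rfl
    have hB := passage_budget_le hs₁pos h12' hm₀pos hc₂ hg hRwc hRw1 hRwge hφ hφ' 
      (fun s hs ↦ hmono s (hsub hs))
    have hB' : ∫ s in s₁..s₂, (((min (|φ s| / 2) (c₂ * s)) ^ 2)⁻¹ +
        ((min (|φ s| / 2) (c₂ * s)) ^ (7 / 4 : ℝ))⁻¹) ≤ Fg + T₁ := by
      refine hB.trans ?_
      rw [hFg, hT₁]
      linarith only [budget_tail_antitone hc₂ ht₀pos h1]
    have hL : Cw * (∫ s in s₁..s₂, (((min (|φ s| / 2) (c₂ * s)) ^ 2)⁻¹ +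
        ((min (|φ s| / 2) (c₂ * s)) ^ (7 / 4 : ℝ))⁻¹)) + ew s₁ ≤ Cw * (Fg + T₁) + ε := by
      have := mul_le_mul_of_nonneg_left hB' hCw
      linarith only [this, hew s₁ h1I]
    have h := pair_velocity_increment_le (W₁ := Qw s₁) (W₂ := Qw s₂) hMx hMy
      (one_le_gammaFactor ((hvxk s₁ h1I).trans_lt hk1)) (one_le_gammaFactor ((hvyk s₁ h1I).trans_lt hk1))
      (one_le_gammaFactor ((hvxk s₂ h2I).trans_lt hk1)) (one_le_gammaFactor ((hvyk s₂ h2I).trans_lt hk1))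
      ((hvxk s₁ h1I).trans hk1.le) ((hvyk s₁ h1I).trans hk1.le)
      (hrxy s₁ h1I) (hrxy s₂ h2I) (hid s₁ ⟨le_rfl, h12'⟩) (hid s₂ ⟨h12', le_rfl⟩)
      (fun μ ↦ (hlaw μ).trans hL)
    refine h.trans ?_
    have : 4 * (Cw * (Fg + T₁) + ε + ew s₁ + ew s₂) / (Mx + My) ≤
        4 * (Cw * (Fg + T₁) + 3 * ε) / (Mx + My) := by
      apply div_le_div_of_nonneg_right _ (add_pos hMx hMy).le
      linarith only [hew s₁ h1I, hew s₂ h2I]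
    linarith only [h, this]
  -- (W) the wide regime
  have hΔW : ‖vx σ₁ - vx t₀‖ ≤ 4 * (Cx * (Fg + T₆) + 3 * ε) / Mx := by
    rcases hW with h | h
    · rw [h, sub_self, norm_zero]; positivity
    · refine hsing t₀ σ₁ (Fg + T₆) le_rfl h01 hσ₁I.2 ?_
      have hsub : Set.Icc t₀ σ₁ ⊆ Set.Icc t₀ τ := Set.Icc_subset_Icc le_rfl hσ₁I.2
      have hc6 : 0 < c₂ / 6 := by positivity
      have hRge' : ∀ s ∈ Set.Icc t₀ σ₁, min (max m₀ |φ₁ s| / 3) (c₂ / 6 * s) ≤ Rx s := by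
        intro s hs
        have hk0 := h s hs
        rw [hkf] at hk0
        have hR := hRxge s (hsub hs)
        have hf := hfl₁ s (hsub hs)
        refine le_trans ?_ hR
        -- `min(max(m₀,|φ₁|)/3, c₂ s/6) ≤ min(min(d_bx, d)/3, c₂ s)`
        have hs0 : 0 ≤ s := ht₀pos.le.trans hs.1
        refine le_min ?_ ((min_le_right _ _).trans (by nlinarith only [hs0, hc₂]))
        rcases le_total ‖ξb s - ξx s‖ (d s) with hle | hle
        · rw [min_eq_left hle]; exact (min_le_left _ _).trans (by linarith only [hf])
        · rw [min_eq_right hle]; exact (min_le_right _ _).trans (by linarith only [hk0])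
      have := passage_budget_le ht₀pos h01 hm₀pos hc6 hg (hRxc.mono hsub) (fun s hs ↦ hRx1 s (hsub hs))
        hRge' hφ₁ hφ₁' (fun s hs ↦ hmono₁ s (hsub hs))
      rw [hFg, hT₆]; exact this
  -- (A) the approach regime
  have hΔA : ‖vx σ₂ - vx σ₁‖ ≤ 4 * (Cw * (Fg + T₁) + 3 * ε) / (Mx + My) + 3 * β₀ := by
    rcases hA with h | h
    · rw [h, sub_self, norm_zero]; positivity
    · refine hpairinc σ₁ σ₂ h01 h12 hσ₂I.2 fun s hs ↦ ?_
      obtain ⟨hk0, hg0⟩ := h s hs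
      rw [hkf] at hk0
      rw [hgm] at hg0
      exact ⟨by linarith only [hg0, neg_abs_le (φ s)], by linarith only [hk0]⟩
  -- (Pa) the passage
  have hΔP : ‖vx σ₃ - vx σ₂‖ ≤ 4 * (Cx * (Fg + T₁ + Λm) + 3 * ε) / Mx := by
    rcases hPa with h | h
    · rw [h, sub_self, norm_zero]; positivity
    · refine hsing σ₂ σ₃ (Fg + T₁ + Λm) hσ₂I.1 h23 h3τ ?_
      have hsub : Set.Icc σ₂ σ₃ ⊆ Set.Icc t₀ τ := Set.Icc_subset_Icc hσ₂I.1 h3τ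
      have hσ₂pos : 0 < σ₂ := ht₀pos.trans_le hσ₂I.1
      have hD₂m : m₀ ≤ d σ₂ := hdfloor σ₂ hσ₂I
      have hD₂pos : 0 < d σ₂ := hm₀pos.trans_le hD₂m
      -- duration of the passage
      have habs : ∀ s ∈ Set.Icc σ₂ σ₃, |φ s| ≤ 4 * d s := by
        intro s hs
        obtain ⟨-, hg1, hg2⟩ := h s hs
        rw [hgm] at hg1
        rw [hgp] at hg2
        rw [abs_le]; constructor <;> linarith only [hg1, hg2]
      have hdur : σ₃ - σ₂ ≤ 16 * d σ₂ / g := by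
        have h1 := hφgrow σ₂ hσ₂I σ₃ hσ₃I h23
        have h2 := habs σ₂ ⟨le_rfl, h23⟩
        have h3 := habs σ₃ ⟨h23, le_rfl⟩
        have h4 := hdslow σ₂ hσ₂I σ₃ hσ₃I h23
        rw [abs_le] at h2 h3 h4
        rw [le_div_iff₀ hg]
        nlinarith only [h2.1, h2.2, h3.1, h3.2, h4.2, hβg, h1, h23, hβ₀, hg]
      have hdlow : ∀ s ∈ Set.Icc σ₂ σ₃, d σ₂ / 2 ≤ d s := by
        intro s hs
        have h4 := hdslow σ₂ hσ₂I s (hsub hs) hs.1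
        rw [abs_le] at h4
        have hs3 : s - σ₂ ≤ 16 * d σ₂ / g := by linarith only [hs.2, hdur]
        have h6 : 2 * β₀ * (s - σ₂) ≤ 2 * β₀ * (16 * d σ₂ / g) :=
          mul_le_mul_of_nonneg_left hs3 (by positivity)
        have h5 : 2 * β₀ * (16 * d σ₂ / g) ≤ d σ₂ / 2 := by
          rw [show 2 * β₀ * (16 * d σ₂ / g) = (32 * β₀ / g) * d σ₂ by ring]
          have : 32 * β₀ / g ≤ 1 / 2 := by
            rw [div_le_iff₀ hg]; linarith only [hβg]
          nlinarith only [this, hD₂pos]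
        linarith only [h4.1, h6, h5]
      have hB := passage_interval_budget_le (R := Rx) (d₁ := fun s ↦ ‖ξb s - ξx s‖) (d := d)
        hσ₂pos h23 hm₀pos hc₂ hg hD₂pos (hRxc.mono hsub) (hξb.sub hdx.continuous).norm hdcont
        (fun s hs ↦ hRx1 s (hsub hs)) (fun s hs ↦ hRxge s (hsub hs)) (fun s hs ↦ hfl₁ s (hsub hs))
        hφ₁ hφ₁' (fun s hs ↦ hmono₁ s (hsub hs)) hdlow hdur
      refine hB.trans ?_
      have hterm := passage_duration_term_le hm₀ hD₂m hg
      have htail := budget_tail_antitone hc₂ ht₀pos hσ₂I.1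
      rw [hFg, hT₁, hΛm]
      linarith only [hterm, htail]
  -- (Re) the recession regime
  have hΔR : ‖vx τ - vx σ₃‖ ≤ 4 * (Cw * (Fg + T₁) + 3 * ε) / (Mx + My) + 3 * β₀ := by
    rcases hRe with h | h
    · rw [h, sub_self, norm_zero]; positivity
    · refine hpairinc σ₃ τ hσ₃I.1 h3τ le_rfl fun s hs ↦ ?_
      obtain ⟨hk0, hg0⟩ := h s hs
      rw [hkf] at hk0
      rw [hgp] at hg0
      exact ⟨by linarith only [hg0, le_abs_self (φ s)], by linarith only [hk0]⟩
  -- assemble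
  have hsplit : vx τ - vx t₀ = (vx τ - vx σ₃) + (vx σ₃ - vx σ₂) + (vx σ₂ - vx σ₁) + (vx σ₁ - vx t₀) := by
    abel
  calc ‖vx τ - vx t₀‖ = ‖(vx τ - vx σ₃) + (vx σ₃ - vx σ₂) + (vx σ₂ - vx σ₁) + (vx σ₁ - vx t₀)‖ := by
        rw [hsplit]
    _ ≤ ‖vx τ - vx σ₃‖ + ‖vx σ₃ - vx σ₂‖ + ‖vx σ₂ - vx σ₁‖ + ‖vx σ₁ - vx t₀‖ := by
        refine (norm_add_le _ _).trans (add_le_add ((norm_add_le _ _).trans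
          (add_le_add (norm_add_le _ _) le_rfl)) le_rfl)
    _ ≤ _ := by linarith only [hΔW, hΔA, hΔP, hΔR]

end TightPairMember

end Summit.FinalStateConjecture.FinalStateConjecture.Theorems.ChargeKinematics

namespace Summit.FinalStateConjecture.FinalStateConjecture.Theorems

/-- REGISTERED STUB `tight_pair_member_increment_le` of the crux item stmt-FinalStateConjecture-10166 (second line lead, line
`old-light-leaves-the-cone`, S4 escape series): the registered one-line signature verbatim, discharged by
`ChargeKinematics.tight_pair_member_increment_le`. [folklore] -/
theorem tight_pair_member_increment_le : open Literature.Geometry.Lorentzian Filter Topology MeasureTheory intervalIntegral in ∀ {ξx ξb vx vy : ℝ → E3} {Qx Qw : ℝ → Fin 4 → ℝ} {Rx ex ew d φ φ' φ₁ φ₁' : ℝ → ℝ} {Mx My Cx Cw k t₀ τ m₀ c₂ g β₀ ε : ℝ} (hMx : 0 < Mx) (hMy : 0 < My) (hk1 : k < 1) (ht₀ : 1 ≤ t₀) (hτ : t₀ ≤ τ) (hm₀ : 1 ≤ m₀) (hc₂ : 0 < c₂) (hct : 1 ≤ c₂ * t₀) (hg : 0 < g) (hβ₀ : 0 < β₀)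 (hβg : 64 * β₀ ≤ g) (hβc : 4 * β₀ ≤ c₂) (hCx : 0 ≤ Cx) (hCw : 0 ≤ Cw) (hε : 0 ≤ ε) (hdx : Differentiable ℝ ξx) (hξb : Continuous ξb) (hvxk : ∀ s ∈ Set.Icc t₀ τ, ‖vx s‖ ≤ k) (hvyk : ∀ s ∈ Set.Icc t₀ τ, ‖vy s‖ ≤ k) (hdcont : Continuous d) (hdfloor : ∀ s ∈ Set.Icc t₀ τ, m₀ ≤ d s) (hdslow : ∀ s ∈ Set.Icc t₀ τ, ∀ s' ∈ Set.Icc t₀ τ, s ≤ s' → |d s' - d s| ≤ 2 * β₀ * (s' - s)) (hrxy : ∀ s ∈ Set.Icc t₀ τ, ‖vy s - vx s‖ ≤ 3 * β₀ / 2) (hlawx : ∀ t₁ t₂, t₀ ≤ t₁ → t₁ ≤ t₂ → t₂ ≤ τ → ∀ μ : Fin 4, |Qx t₂ μ - Qx t₁ μ| ≤ Cx * (∫ s in t₁..t₂, ((Rx s) ^ 2)⁻¹ + ((Rx s) ^ (7 / 4 : ℝ))⁻¹) + ex t₁) (hidx : ∀ t ∈ Set.Icc t₀ τ, |Qx t 0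 - Mx * (√(1 - ‖vx t‖ ^ 2))⁻¹| ≤ ex t ∧ ∀ k' : Fin 3, |Qx t k'.succ - Mx * (√(1 - ‖vx t‖ ^ 2))⁻¹ * vx t k'| ≤ ex t) (hex : ∀ t ∈ Set.Icc t₀ τ, ex t ≤ ε) (hRxc : ContinuousOn Rx (Set.Icc t₀ τ)) (hRx1 : ∀ s ∈ Set.Icc t₀ τ, 1 ≤ Rx s) (hRxge : ∀ s ∈ Set.Icc t₀ τ, min (min ‖ξb s - ξx s‖ (d s) / 3) (c₂ * s) ≤ Rx s) (hφ₁ : ∀ s, HasDerivAt φ₁ (φ₁' s) s) (hφ₁' : Continuous φ₁') (hmono₁ : ∀ s ∈ Set.Icc t₀ τ, g ≤ φ₁' s) (hfl₁ : ∀ s ∈ Set.Icc t₀ τ, max m₀ |φ₁ s| ≤ ‖ξb s - ξx s‖) (hφ : ∀ s, HasDerivAt φ (φ' s) s) (hφ' : Continuous φ') (hmono : ∀ s ∈ Set.Icc t₀ τ, g ≤ φ' s) (hpair : ∀ s₁ s₂, t₀ ≤ s₁ → s₁ ≤ s₂ → s₂ ≤ τ → (∀ s ∈ Set.Icc s₁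 s₂, 4 * d s ≤ |φ s| ∧ 2 * d s ≤ c₂ * s) → (∀ μ : Fin 4, |Qw s₂ μ - Qw s₁ μ| ≤ Cw * (∫ s in s₁..s₂, ((min (|φ s| / 2) (c₂ * s)) ^ 2)⁻¹ + ((min (|φ s| / 2) (c₂ * s)) ^ (7 / 4 : ℝ))⁻¹) + ew s₁) ∧ (∀ s ∈ Set.Icc s₁ s₂, |Qw s 0 - (Mx * (√(1 - ‖vx s‖ ^ 2))⁻¹ + My * (√(1 - ‖vy s‖ ^ 2))⁻¹)| ≤ ew s ∧ ∀ k' : Fin 3, |Qw s k'.succ - (Mx * (√(1 - ‖vx s‖ ^ 2))⁻¹ * vx s k' + My * (√(1 - ‖vy s‖ ^ 2))⁻¹ * vy s k')| ≤ ew s)) (hew : ∀ t ∈ Set.Icc t₀ τ, ew t ≤ ε), ‖vx τ - vx t₀‖ ≤ 4 * (Cx * (9 * (2 * 2 * m₀ ^ (1 - 2 : ℝ) / ((2 - 1) * g)) + (3 : ℝ) ^ (7 / 4 : ℝ) * (2 * (7 / 4) * m₀ ^ (1 - 7 / 4 : ℝ) / ((7 / 4 - 1) * g)) + (((c₂ /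 6) ^ 2 * t₀)⁻¹ + 4 / 3 * (c₂ / 6) ^ (-(7 / 4) : ℝ) * t₀ ^ (-(3 / 4) : ℝ))) + 3 * ε) / Mx + (4 * (Cx * ((9 * (2 * 2 * m₀ ^ (1 - 2 : ℝ) / ((2 - 1) * g)) + (3 : ℝ) ^ (7 / 4 : ℝ) * (2 * (7 / 4) * m₀ ^ (1 - 7 / 4 : ℝ) / ((7 / 4 - 1) * g)) + ((c₂ ^ 2 * t₀)⁻¹ + 4 / 3 * c₂ ^ (-(7 / 4) : ℝ) * t₀ ^ (-(3 / 4) : ℝ))) + 1152 / g * m₀ ^ (-(3 / 4) : ℝ)) + 3 * ε) / Mx) + 2 * (4 * (Cw * (9 * (2 * 2 * m₀ ^ (1 - 2 : ℝ) / ((2 - 1) * g)) + (3 : ℝ) ^ (7 / 4 : ℝ) * (2 * (7 / 4) * m₀ ^ (1 - 7 / 4 : ℝ) / ((7 / 4 - 1) * g)) + ((c₂ ^ 2 * t₀)⁻¹ + 4 / 3 * c₂ ^ (-(7 / 4) : ℝ) * t₀ ^ (-(3 / 4) : ℝ))) + 3 * ε) / (Mx + My) + 3 * β₀) :=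
  @ChargeKinematics.tight_pair_member_increment_le

end Summit.FinalStateConjecture.FinalStateConjecture.Theorems

end
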